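import Summits.HodgeConjecture.HodgeConjecture.Theorems.HeckePrymWeilHeckePrymAnchorsCMAnchorWeilLine
import Summits.HodgeConjecture.HodgeConjecture.Theorems.HeckePrymWeilHeckePrymAnchorsCMProjector
import HarnessLib

/-!
# Deligne's family in algebraic-anchor form from the period construction ALONE (item stmt-HodgeConjecture-14496, route HeckePrymWeil)

Line `Sketch`, continuation lead c34 — the RIEMANN-FREE CLOSURE of the crux `HeckePrymAnchors`, main
step. The registered stub of the line is the route decl `DeligneWeilFamily` (item
stmt-HodgeConjecture-16866), whose residual in the tree is [U] ∧ [F]: Deligne's period construction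
(hypothesis `h` of
`HodgeTheory/WeilFamilyLevelStructureOfPeriodConstruction.deligne1982_weilFamily_levelStructure_of_periodConstruction`)
and Riemann's theorem / fullness of `H¹` (hypothesis `hF`, only consumer: the tensor-isogeny clause
(b) of 16866). This file proves, from [U] ONLY,

* `kActionAlg_of_periodConstruction` — the charts-only family package through every `(X, Φ)` with a
  non-zero rational Hodge Weil class, in ALGEBRAIC-ANCHOR form (the hypothesis of the landed
  `heckePrymAnchors_of_kActionAlg`, `Theorems/HeckePrymWeilHeckePrymAnchorsOfAlgebraicAnchor`): the
  family, its global `√-p`, the charts and the flat section through `e^{-1 *} c` exactly as in the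
  tree's reduction (level structure ⟹ flat section, `exists_continuous_section_of_integral_level`);
  and at the fibre `Y` over the rational diagonal CM point `J_R` (period surjectivity at ONE point) the
  strong Weil plane is ALGEBRAIC by the KEY LEMMA `cm_weilClassesOf_le_algebraicClasses`
  (`…CMAnchorWeilLine`: Lefschetz `(1,1)` on `Y` + Kleiman moving) fed with the CM projector
  `cm_projector_of_periodPoint` (`…CMProjector`) and balancedness of `Y` (Prop. 4.4 at `X`, transported
  along the connected base).

The composition with `heckePrymAnchors_of_kActionAlg` ([U] ⟹ `HeckePrymAnchors`) is the sequel file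
`Theorems/HeckePrymWeilHeckePrymAnchorsOfPeriodConstructionCrux`. So the residual of THIS crux is the
period construction [U] alone (Deligne's `Γ\B → Γ\X⁺`, Baily–Borel/Borel,
[MumfordFogartyKirwan1994, Thm. 7.9]); Riemann's theorem drops out. No definition, no `sorry`; the
only hypothesis is [U], displayed verbatim.
-/

noncomputable section

-- every declaration of this problem lives in `Summit.HodgeConjecture.HodgeConjecture.…` (summit = sub-problem)
set_option linter.dupNamespace false

open CategoryTheory AlgebraicGeometry Limits MonoidalCategory CartesianMonoidalCategory
open Literature.AlgebraicTopology.SingularHomology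
open scoped TensorProduct

namespace Summit.HodgeConjecture.HodgeConjecture.Theorems.HeckePrymWeilLine

open Literature.AlgebraicGeometry Literature.AlgebraicGeometry.Motives Literature.AlgebraicGeometry.HodgeTheory

/-- **Deligne's abelian scheme with `K`-action in algebraic-anchor form, from the period construction
ALONE.** Suppose the PERIOD CONSTRUCTION [U] (hypothesis `h` of
`deligne1982_weilFamily_levelStructure_of_periodConstruction`, verbatim: for every complex abelian
`2n`-fold `(P, ψ₀)` with `ψ₀ ≫ ψ₀ = -d`, a smooth projective family through `P` over a smooth
irreducible quasi-projective base embedded in `ℙᴺ × S`, the global `√-d` with fibre charts, a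
level-`n'` structure at the base point, and PERIOD SURJECTIVITY onto `X⁺(D_P)`;
[Deligne1982HodgeCycles], proof of Thm. 4.8, pp. 48–51). Then the charts-only family package through
every `(X, Φ)` with a non-zero rational Hodge Weil class holds in ALGEBRAIC-ANCHOR form: the fibre over
the rational diagonal CM point `J_R` of `X⁺(D_X)` (`WeilDatum.exists_isWeilComplexStructure_rational`)
has an algebraic strong Weil plane — by the KEY LEMMA `cm_weilClassesOf_le_algebraicClasses` applied
to the CM projector `cm_projector_of_periodPoint` (balancedness of the fibre by Prop. 4.4 at `X` and
transport along the connected base, as in the tree's reduction), with NO appeal to Riemann's theorem /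
fullness [F]. The flat section through `e^{-1 *} c` comes from the level structure exactly as in
`deligne1982_weilFamily_kAction_of_levelStructure`.
[cite: Deligne1982HodgeCycles, proof of Thm. 4.8 (pp. 47–52), Prop. 4.4, Lemma 4.5]
[cite: vanGeemen1994HodgeAV, 5.3–5.11] [cite: MumfordFogartyKirwan1994, Thm. 7.9–7.10] -/
theorem kActionAlg_of_periodConstruction :
    (∀ (n d : ℕ), 1 ≤ n → 1 ≤ d → ∀ (P : AbelianVariety ℂ) (ψ₀ : P ⟶ P) (e : ProjectiveEmbedding P.X) (a : complexBetti (projectiveSpace e.n ℂ) 2), P.dim = 2 * n → ψ₀ ≫ ψ₀ = -((d : ℤ) • 𝟙 P) → ∀ (ha : IsRationalClass a) (ha0 : a ≠ 0), ∃ (𝒳 S : SchemeOver ℂ) (f : 𝒳 ⟶ S) (g : 𝒳 ⟶ 𝒳) (s₀ : ComplexPoints S) (e' : P.X ≅ fiberOver f s₀) (Y : ComplexPoints S → AbelianVariety ℂ) (Ψ : ∀ s, Y s ⟶ Y s) (ε : ∀ s, (Y s).X ≅ fiberOver f s) (N : ℕ) (ι : 𝒳 ⟶ CategoryTheory.MonoidalCategoryStruct.tensorObj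 (projectiveSpace N ℂ) S), IsSmoothProjectiveFamily f (2 * n) ∧ AlgebraicGeometry.IsClosedImmersion ι.left ∧ ι ≫ CategoryTheory.CartesianMonoidalCategory.snd (projectiveSpace N ℂ) S = f ∧ IrreducibleSpace S.left ∧ AlgebraicGeometry.Smooth S.hom ∧ IsQuasiProjectiveOver S ∧ g ≫ f = f ∧ (e'.hom ≫ fiberι f s₀) ≫ g = ψ₀.hom.hom.hom ≫ (e'.hom ≫ fiberι f s₀) ∧ (∀ s, (Y s).dim = 2 * n ∧ Ψ s ≫ Ψ s = -((d : ℤ) • 𝟙 (Y s)) ∧ ((ε s).hom ≫ fiberι f s) ≫ g = (Ψ s).hom.hom.hom ≫ ((ε s).hom ≫ fiberι f s)) ∧ (∃ (ιb : Type) (_ : Fintype ιb) (_ : DecidableEq ιb) (b : Module.Basis ιb ℂ (complexBetti (fiberOver f s₀) 1)) (Jℤ : Matrix ιb ιb ℤ) (n' : ℕ), 3 ≤ n' ∧ (∀ g₀ : fiberOver f s₀ ⟶ fiberOver f s₀, g₀ ≫ fiberι f s₀ = fiberι f s₀ ≫ g → LinearMap.toMatrix b b (complexBetti.map g₀ 1).hom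 = Jℤ.map (Int.castRingHom ℂ)) ∧ ∀ (hU : IsCohomologicallyLocallyTrivialOn f (Set.univ : Set (ComplexPoints S))) (γ : Path.Homotopic.Quotient (⟨s₀, Set.mem_univ s₀⟩ : (Set.univ : Set (ComplexPoints S))) ⟨s₀, Set.mem_univ s₀⟩), ∃ Dℤ : Matrix ιb ιb ℤ, LinearMap.toMatrix b b (transportLinear f 1 hU γ :) = (1 + (n' : ℤ) • Dℤ).map (Int.castRingHom ℂ)) ∧ ∃ (m : ℕ) (hm : 1 ≤ m) (hPm : P.dim = m + 1) (hd : 0 < d) (hψ : ψ₀ ≫ ψ₀ = -(d • 𝟙 P)) (ω : complexBetti P.X (2 + 2 * m)) (hω : IsRationalClass ω) (hω0 : ω ≠ 0), ∀ (J : (weilDatumOfKsymm hm hPm hd hψ e ha ha0 hω hω0).Cx →ₗ[ℂ] (weilDatumOfKsymm hm hPm hd hψ e ha ha0 hω hω0).Cx) (hW : Motives.IsWeilComplexStructure (weilDatumOfKsymm hm hPm hd hψ e ha ha0 hω hω0).hForm J), ∃ (s : ComplexPoints S) (β : bettiCohomology P.X 1 ≃ₗ[ℚ] bettiCohomology (Y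 s).X 1), (∀ x, β (bettiCohomology.map ψ₀.hom.hom.hom 1 x) = bettiCohomology.map (Ψ s).hom.hom.hom 1 (β x)) ∧ ∀ x ∈ ((weilDatumOfKsymm hm hPm hd hψ e ha ha0 hω hω0).hodgeStructure J hW.sq).piece 1 0, IsOfHodgeType (2 * n) (Y s).X 1 1 0 (Motives.ofRatClassBaseChange (ComplexPoints (Y s).X) 1 (β.toLinearMap.baseChange ℂ x))) → ∀ p : ℕ, p.Prime → p % 4 = 3 → 7 ≤ p → ∀ (k : ℕ), 1 ≤ k → ∀ (X : AbelianVariety ℂ) (Φ : X ⟶ X), X.dim = 2 * k → Φ ≫ Φ = -((p : ℤ) • 𝟙 X) → ∀ c : complexBetti X.X (2 * k), c ∈ weilClassesOf X Φ k p → c ≠ 0 → IsRationalClass c → IsOfHodgeType (2 * k) X.X (2 * k) k k c → ∃ (𝒳 S : SchemeOver ℂ) (f : 𝒳 ⟶ S) (g : 𝒳 ⟶ 𝒳) (s₁ s₀ : ComplexPoints S) (e : X.X ≅ fiberOver f s₁) (σ : ComplexPoints S → FiberClass f (2 * k)), IsSmoothProjectiveFamily f (2 * k) ∧ (∃ (N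 : ℕ) (ι : 𝒳 ⟶ projectiveSpace N ℂ ⊗ S), IsClosedImmersion ι.left ∧ ι ≫ snd (projectiveSpace N ℂ) S = f) ∧ IrreducibleSpace S.left ∧ AlgebraicGeometry.Smooth S.hom ∧ IsQuasiProjectiveOver S ∧ g ≫ f = f ∧ (∀ s : ComplexPoints S, ∃ (A' : AbelianVariety ℂ) (φ' : A' ⟶ A') (e' : A'.X ≅ fiberOver f s), A'.dim = 2 * k ∧ φ' ≫ φ' = -((p : ℤ) • 𝟙 A') ∧ (e'.hom ≫ fiberι f s) ≫ g = φ'.hom.hom.hom ≫ (e'.hom ≫ fiberι f s)) ∧ (e.hom ≫ fiberι f s₁) ≫ g = Φ.hom.hom.hom ≫ (e.hom ≫ fiberι f s₁) ∧ Continuous σ ∧ (∀ s, (σ s).pt = s) ∧ σ s₁ = ⟨s₁, complexBetti.map e.inv (2 * k) c⟩ ∧ ∃ (Y : AbelianVariety ℂ) (Ψ : Y ⟶ Y) (e₀ : Y.X ≅ fiberOver f s₀), weilClassesOf Y Ψ k p ≤ algebraicClasses Y.X k ∧ (e₀.hom ≫ fiberι f s₀) ≫ g = Ψ.hom.hom.hom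 ≫ (e₀.hom ≫ fiberι f s₀) := by
  intro h p hp hp4 hp7 k hk X Φ hX hΦ c hc hc0 hrat hH
  have hp0 : 0 < p := hp.pos
  -- a projective embedding of `X` and a non-zero rational class on its projective space
  have hXsp : IsSmoothProjective (2 * k) X.X := Motives.isSmoothProjective_of_dim_eq' hX
  let eX : ProjectiveEmbedding X.X := hXsp.isProjectiveOver.projectiveEmbedding
  have hNX : 1 ≤ eX.n := le_trans (by omega) (le_of_isClosedImmersion_projectiveSpace hXsp eX.ι)
  obtain ⟨a, ha, ha0⟩ := exists_isRationalClass_ne_zero_projectiveSpace hNX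
  -- the period construction through `X`
  obtain ⟨𝒳, S, f, g, s₁, e, Yf, Ψf, ε, N, ι, hfam, hιci, hιf, hirr, hsm, hSqp, hg, he, hfib, hlev, hU⟩ :=
    h k p hk hp0 X Φ eX a hX hΦ ha ha0
  obtain ⟨m, hm, hXm, hd, hΦ', ω, hω, hω0, hsurj⟩ := hU
  set D := weilDatumOfKsymm hm hXm hd hΦ' eX ha ha0 hω hω0 with hD
  haveI : FiniteDimensional ℚ (bettiCohomology X.X 1) := finite_bettiCohomology_one X
  have hV : Module.finrank ℚ (bettiCohomology X.X 1) = 4 * k := by rw [finrank_bettiCohomology_one, hX]; ring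
  -- the rational point `J_R` of `X⁺(D)` and the fibre `Y = Y_{s₀}` over it
  obtain ⟨P, Nn, R, hRα, hPα, hNα, hcpl, -, -, -, -, -, -, -, -, hW, hEP, hEN, -, -⟩ :=
    D.exists_isWeilComplexStructure_rational
  obtain ⟨s₀, β, hβK, hβH⟩ := hsurj _ hW
  obtain ⟨hY₀, hΨ₀, hε₀⟩ := hfib s₀
  have hY₀sp : IsSmoothProjective (2 * k) (Yf s₀).X := Motives.isSmoothProjective_of_dim_eq' hY₀
  have hβH' : ∀ x ∈ HodgeStructure.cxF1 (D.realJ ((D.c : ℂ) • D.cxMap R hRα)),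
      IsOfHodgeType (2 * k) (Yf s₀).X 1 1 0
        (Motives.ofRatClassBaseChange (ComplexPoints (Yf s₀).X) 1 (β.toLinearMap.baseChange ℂ x)) :=
    fun x hx => hβH x (by rwa [WeilDatum.piece_one_zero_hodgeStructure])
  have hβK' : ∀ x, β (D.α x) = bettiCohomology.map (Ψf s₀).hom.hom.hom 1 (β x) := fun x => hβK x
  -- the base: `S(ℂ)` is a (locally) path-connected manifold and `R• f_* ℂ` is a local system on it
  haveI := hsm
  haveI := hirr
  haveI : LocallyOfFiniteType S.hom := hSqp.locallyOfFiniteType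
  haveI : ConnectedSpace (ComplexPoints S) := (Motives.ComplexPoints.connectedSpace_iff_holds S).2 inferInstance
  obtain ⟨dS, hdS⟩ := exists_smoothOfRelativeDimension_of_connectedSpace_complexPoints S
  haveI := hdS
  haveI := pathConnectedSpace_complexPoints_of_smoothOfRelativeDimension S dS
  letI := Motives.ComplexPoints.chartedSpace S dS
  haveI : LocallyPathConnectedSpace (ComplexPoints S) :=
    ChartedSpace.locallyPathConnectedSpace (EuclideanSpace ℝ (Fin (2 * dS))) (ComplexPoints S)
  have hUct := isCohomologicallyLocallyTrivialOn_univ_of_isSmoothProjectiveFamily f dS hfam hSqp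
  have hgf' := fun t ↦ exists_fiberHom_comp_fiberι f g hg t
  choose gf hgf using hgf'
  have hsp : ∀ t : ComplexPoints S, IsSmoothProjective (2 * k) (fiberOver f t) := fun t ↦ hfam.isSmoothProjective t
  obtain ⟨mε, εm, hεm⟩ := exists_forall_isClosedImmersion_fiberι_comp f hfam ⟨N, ι, hιci, hιf⟩ hSqp
  -- the chart at `s₁`
  haveI := finite_complexBetti (hfam.isSmoothProjective s₁) 1
  have hΦ'' : Φ ≫ Φ = -(p • 𝟙 X) := by rw [hΦ, natCast_zsmul]
  have he' : e.hom ≫ gf s₁ = Φ.hom.hom.hom ≫ e.hom :=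
    hom_comp_fiberHom_eq_of_comp_fiberι f g (hgf s₁) e Φ.hom.hom.hom he
  set μ : ℂ := Complex.I * (Real.sqrt p : ℂ) with hμ
  have hE₁ : Module.finrank ℂ ↥(Module.End.eigenspace (complexBetti.map (gf s₁) 1).hom μ) = 2 * k := by
    rw [finrank_eigenspace_eq_of_iso e (gf s₁) he' μ 1]
    have h2 := two_mul_finrank_eigenspace_eq hp0 hΦ''
    rw [Motives.AbelianVariety.finrank_complexBetti_one, hX, ← hμ] at h2
    omega
  /- (i) `Y` is balanced: `X` is (Prop. 4.4 applied to `c`), and the multiplicity is constant along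
    the connected base. -/
  have hbalY : Module.finrank ℂ ↥(Module.End.eigenspace (complexBetti.map (Ψf s₀).hom.hom.hom 1).hom μ ⊓
      hodgeOneZero hY₀sp) = k := by
    have hbal₁ : Module.finrank ℂ ↥(Module.End.eigenspace (complexBetti.map (gf s₁) 1).hom μ ⊓
        hodgeOneZero (hsp s₁)) = k := by
      rw [finrank_eigenspace_inf_hodgeOneZero_eq_of_iso hX (hsp s₁) e (gf s₁) he' μ]
      exact finrank_eq_of_mem_weilClassesOf hk hX hp0 hΦ'' hc hc0 hH
    have hε₀' : (ε s₀).hom ≫ gf s₀ = (Ψf s₀).hom.hom.hom ≫ (ε s₀).hom :=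
      hom_comp_fiberHom_eq_of_comp_fiberι f g (hgf s₀) (ε s₀) (Ψf s₀).hom.hom.hom hε₀
    let γ : Path (⟨s₁, Set.mem_univ s₁⟩ : (Set.univ : Set (ComplexPoints S))) ⟨s₀, Set.mem_univ s₀⟩ :=
      (PathConnectedSpace.somePath s₁ s₀).map (continuous_id.subtype_mk _)
    rw [← finrank_eigenspace_inf_hodgeOneZero_eq_of_iso hY₀ (hsp s₀) (ε s₀) (gf s₀) hε₀' μ]
    exact finrank_eigenspace_inf_hodgeOneZero_eq_of_path' f (by omega) hsp hUct g hg gf hgf μ εm hεm ⟦γ⟧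
      hE₁ hbal₁
  /- (ii) the CM projector at `Y` and the KEY LEMMA: the strong Weil plane of `(Y, Ψ)` is algebraic. -/
  have hι : D.iSqrt = μ := by
    rw [hμ, WeilDatum.iSqrt, hD, weilDatumOfKsymm_d, Rat.cast_natCast]
  obtain ⟨Pr, hPr, hPrT, hPrrat, hrange, hker⟩ :=
    cm_projector_of_periodPoint hY₀ hV D hRα hPα hNα hcpl hW.sq hEP hEN β (Ψf s₀) hβK' hβH'
  rw [hι] at hrange hker
  have hΨ₀' : Ψf s₀ ≫ Ψf s₀ = -(p • 𝟙 (Yf s₀)) := by rw [hΨ₀, natCast_zsmul]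
  have hWalg : weilClassesOf (Yf s₀) (Ψf s₀) k p ≤ algebraicClasses (Yf s₀).X k :=
    cm_weilClassesOf_le_algebraicClasses hp0 hk hY₀ hΨ₀' Pr hPr hPrT hPrrat hrange hker hbalY
  /- (iii) the flat section through `e^{-1 *} c` from the level structure (as in
    `deligne1982_weilFamily_kAction_of_levelStructure`). -/
  obtain ⟨ιb, _, _, b, Jℤ, n', hn', hJb, hlevel⟩ := hlev
  have hJ := hJb (gf s₁) (hgf s₁)
  have hGG : (complexBetti.map (gf s₁) 1).hom * (complexBetti.map (gf s₁) 1).hom = -((p : ℂ) • 1) := by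
    have hinjE : Function.Injective (complexBetti.map e.hom 1) := by
      intro v w hvw
      have h1 := congrArg (complexBetti.map e.inv 1) hvw
      rwa [complexBetti_map_inv_map_hom_of_chart, complexBetti_map_inv_map_hom_of_chart] at h1
    have hcommE : ∀ w, complexBetti.map e.hom 1 (complexBetti.map (gf s₁) 1 w) =
        complexBetti.map Φ.hom.hom.hom 1 (complexBetti.map e.hom 1 w) := by
      intro w
      rw [← ModuleCat.comp_apply, ← complexBetti.map_comp, he', complexBetti.map_comp, ModuleCat.comp_apply]
    ext v
    apply hinjE
    change complexBetti.map e.hom 1 (complexBetti.map (gf s₁) 1 (complexBetti.map (gf s₁) 1 v)) =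
      complexBetti.map e.hom 1 ((-((p : ℂ) • (1 : Module.End ℂ _))) v)
    rw [hcommE, hcommE, complexBetti_map_map_one_of_comp_self hΦ'', LinearMap.neg_apply,
      LinearMap.smul_apply, Module.End.one_apply, map_neg, map_smul]
  have hJ2 : Jℤ * Jℤ = -((p : ℤ) • 1) := by
    apply Matrix.map_injective (RingHom.injective_int (Int.castRingHom ℂ))
    change (Jℤ * Jℤ).map _ = (-((p : ℤ) • (1 : Matrix ιb ιb ℤ))).map _
    rw [Matrix.map_mul, ← hJ, ← LinearMap.toMatrix_mul, hGG, map_neg, LinearEquiv.map_smul,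
      LinearMap.toMatrix_one]
    ext i j
    simp only [Matrix.map_apply, Matrix.neg_apply, Matrix.smul_apply, Matrix.one_apply, smul_eq_mul,
      mul_ite, mul_one, mul_zero, eq_intCast, Int.cast_neg, Int.cast_ite, Int.cast_natCast, Int.cast_zero]
  have hEm : Module.finrank ℂ ↥(Module.End.eigenspace (complexBetti.map (gf s₁) 1).hom (-μ)) = 2 * k := by
    rw [finrank_eigenspace_eq_of_iso e (gf s₁) he' _ 1, hμ, ← finrank_eigenspace_eq_finrank_eigenspace_neg hp0 hΦ'',
      ← finrank_eigenspace_eq_of_iso e (gf s₁) he' _ 1]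
    exact hE₁
  let bμ := Module.finBasisOfFinrankEq ℂ _ hE₁
  let bν := Module.finBasisOfFinrankEq ℂ _ hEm
  have hα := map_inv_mem_eigenLines_of_mem_weilClassesOf e (gf s₁) hp0 hX hΦ'' he' hc
  obtain ⟨σ, hσ, hpt, hσ₁⟩ := exists_continuous_section_of_integral_level f hUct g hg gf hgf s₁ b hp0 Jℤ
    hJ hJ2 hn' (hlevel hUct) μ (I_mul_sqrt_sq p) bμ bν hα
  /- (iv) assemble the algebraic-anchor package. -/
  exact ⟨𝒳, S, f, g, s₁, s₀, e, σ, hfam, ⟨N, ι, hιci, hιf⟩, hirr, hsm, hSqp, hg,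
    fun t => ⟨Yf t, Ψf t, ε t, (hfib t).1, (hfib t).2.1, (hfib t).2.2⟩, he, hσ, hpt, hσ₁,
    Yf s₀, Ψf s₀, ε s₀, hWalg, hε₀⟩

end Summit.HodgeConjecture.HodgeConjecture.Theorems.HeckePrymWeilLine

end
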